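import Literature.NumberTheory.Automorphic.UnitaryGroupRestrictedProduct
import Mathlib.NumberTheory.NumberField.CMField
import Mathlib.NumberTheory.NumberField.InfinitePlace.Ramification
import HarnessLib

/-!
# Liu 2021, Appendix C, Definition C.4 («`τ`-nearby») — EXACTLY AS PRINTED (statement-exact typing; no proof)

[Liu2021] = Yifeng Liu, *Fourier–Jacobi cycles and arithmetic relative trace formula* (with an appendix by Chao Li
and Yihang Zhu), Cambridge J. Math. **9** (2021), no. 1, 1–147 = arXiv:2102.11518.  PRIMARY SOURCE READ FOR THIS FILE:
the author's TeX source of the arXiv v2 e-print, `FJcycle.tex` (md5 `6db49a74122d2cb0f224fa1b39488a0c`, 7163 lines; held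
at `run/shared/lean/pub/pub-hodgecm/pub-hodgecm-cf-kudla-howe-rallis-g4/lit/Liu21-arxiv-src/FJcycle.tex`) — every
`l. NNNN` below is a line of that file.  NUMBERING: all numbered environments of the paper share ONE counter within a
section (`\newtheorem{proposition}{Proposition}[section]`, `\newtheorem{definition}[proposition]{Definition}`,
`\newtheorem{remark}[proposition]{Remark}`, l. 51–68), so in Appendix C (`\section{Shimura varieties for hermitian
spaces}`, TeX label `ss:c`, l. 4544) the items are: **C.1** = Definition (reflex field / reduced reflex field of
`(V, Φ)`), l. 4565–4567; **C.2** = Remark `re:picard`, l. 4602–4609; **C.3** = Definition `de:incoherent_hermitian`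
(incoherent hermitian space over `𝔸_E`), l. 4614–4616; **C.4** = Definition `de:nearby` (THIS FILE), l. 4620–4622;
**C.5** = Proposition `pr:incoherent_shimura`, l. 4627–4633; C.6 = Definition `de:shimura_incoherent`, l. 4640–4642;
C.7 = Remark, l. 4644–4654; C.8 = Definition `de:shimura_incoherent_toroidal`, l. 4663–4665; C.9 = Remark, l. 4667–4669.
(The held text extraction `paper:arxiv-2102.11518` numbers Appendix C as ‘9.x’: Def. C.4 = its ‘Definition 9.4’.)
Cambridge J. Math. page numbers are not held (acquisition `acq-07613`) and are not quoted.

Companion files of the same typing effort (coordinator's ruling 2026-08-21T16:13:55Z, «APPENDIX C AS PRINTED, split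
across four typers, interface-first»): `AppendixC/DefC1toC3.lean` (Def. C.1, Rem. C.2, Def. C.3), `AppendixC/PropC5.lean`
(Prop. C.5), `AppendixC/Glue.lean` (how C.1–C.5 feed the hypotheses of Thm. 4.18, `Liu2021/Thm418AsPrinted.lean`).

## The printed text (verbatim from `FJcycle.tex`; TeX macros resolved: `\bV` = `𝕍`, `\bG` = `𝔾`, `\bA` = `𝔸`, `\rV` = `V`,
`\rU` = `U`, `\rG` = `G`, `\dR` = `ℝ`, `\dC` = `ℂ`, `\dQ` = `ℚ`, `\tc` = `c`, `\Nm` = `Nm`, `\Res` = `Res`)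

**Standing data of Appendix C**, l. 4550: «Let `F` be a totally real number field of degree `d ≥ 1`, and `E/F` a totally
imaginary quadratic extension. Denote by `c` the nontrivial involution of `E` over `F`. Denote by `Φ_F` the set of real
embeddings of `F` and by `Φ_E` the set of complex embeddings of `E`. […] We have the projection map `π : Φ_E → Φ_F` given
by restriction. […]»

**§C.1 «Case of isometry»**, l. 4558: «Let `V` be a (non-degenerate) hermitian space over `E` (with respect to `c`) of rank
`n ≥ 1`, with the hermitian form `( , )_V : V × V → E` that is `E`-linear in the first variable. For every `τ ∈ Φ_F`, let
`(p_τ, q_τ)` be the signature of `V ⊗_{F,τ} ℝ`.»  l. 4573: «For every `τ ∈ Φ_F`, we may identify `V ⊗_{E,τ^−} ℂ` with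
`ℂ^{⊕ n}`, hence `U(V) ⊗_{F,τ} ℝ` is identified with the subgroup of `Res_{ℂ/ℝ} GL_n` of elements preserving the hermitian
form given by the matrix `( I_{p_τ} 0 ; 0 −I_{q_τ} )`.» (`τ^−` is an element of `Φ_E` above `τ`, l. 4563.)

**Def. C.3** (l. 4614–4616; typed in `DefC1toC3.lean`): «An *incoherent hermitian space* over `𝔸_E` is a free `𝔸_E`-module
`𝕍` of some rank `n ≥ 1`, equipped with a non-degenerate hermitian form `( , )_𝕍 : 𝕍 × 𝕍 → 𝔸_E` with respect to the
(induced) involution `c` on `𝔸_E` such that its determinant belongs to `𝔸_F^× ∖ F^× Nm_{𝔸_E/𝔸_F} 𝔸_E^×`. We say that `𝕍` is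
totally positive definite if for every `τ ∈ Φ_F`, `𝕍 ⊗_{𝔸_F,τ} ℝ` is positive definite.»

**The sentence introducing `𝕍`**, l. 4618: «Let `𝕍` be a totally positive definite incoherent hermitian space over `𝔸_E`
of rank `n ≥ 1`, and let `𝔾 := U(𝕍)` be its group of isometry, which is a reductive group over `𝔸_F`.»

**DEFINITION C.4** (TeX label `de:nearby`, l. 4620–4622), VERBATIM:
«For `τ ∈ Φ_F`, we say that a hermitian space `V` over `E` is *`τ`-nearby to `𝕍`* if `V ⊗_F 𝔸_F^τ ≃ 𝕍 ⊗_{𝔸_F} 𝔸_F^τ`,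
and `V ⊗_{F,τ} ℝ` has signature `(n−1, 1)`.»

**The sentence after it**, l. 4624 (NOT part of Def. C.4; typed in `Glue.lean`): «It is clear that for every `τ ∈ Φ_F`,
there exists a hermitian space that is `τ`-nearby to `𝕍`, unique up to isomorphism. We fix such a space `V(τ)`. Put
`G(τ) := Res_{F/ℚ} U(V(τ))`. We fix an isomorphism `𝕍 ⊗_{𝔸_F} 𝔸_F^∞ ≃ V(τ) ⊗_F 𝔸_F^∞`, hence an isomorphism
`𝔾(𝔸_F^∞) ≃ G(τ)(𝔸^∞)`.»

NOTATION `𝔸_F^τ` (l. 4621; not in the paper's notation list l. 1121–1136, which has `𝔸^∞ := \hat ℤ_ℚ`, `𝔸 := ℝ × 𝔸^∞`,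
`𝔸_k := 𝔸 ⊗_ℚ k`, `𝔸_k^∞ := 𝔸^∞ ⊗_ℚ k`): by the paper's own superscript convention (`𝔸_F^∞` = adèles away from `∞`;
`𝔸_F^{∞,p}`, l. 3413, = away from `∞` and `p`), `𝔸_F^τ` is the ring of adèles of `F` AWAY FROM THE ARCHIMEDEAN PLACE `τ`:
`𝔸_F^τ = ∏_{τ₁ ∈ Φ_F, τ₁ ≠ τ} F_{τ₁} × 𝔸_F^∞` (`F_{τ₁} = ℝ`), so that `𝔸_F = F_τ × 𝔸_F^τ`; and
`𝕍 ⊗_{𝔸_F} 𝔸_F^τ`, `V ⊗_F 𝔸_F^τ` are hermitian spaces over `𝔸_E ⊗_{𝔸_F} 𝔸_F^τ = E ⊗_F 𝔸_F^τ = ∏_{w ∤ τ} E_w × 𝔸_E^∞`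
(`w` over the archimedean places of `E` not above `τ`; `E` is totally imaginary, so each `τ₁ ∈ Φ_F` has exactly one place
`w` of `E` above it, with `E_w ≅ ℂ`).  «`≃`» between hermitian spaces is an isometry (an isomorphism of modules
respecting the forms), as everywhere in App. C (e.g. l. 4624 «unique up to isomorphism», l. 5174 «is an isometry»).

## The typing — how the printed objects are presented (READ THIS BEFORE AUDITING)

Everything below is a genuine Lean object; nothing is posited and NOTHING IS ASSERTED (Def. C.4 is a definition: this file
declares PREDICATES and proves only definitional unfoldings).

* `F`, `E` (l. 4550): the predicates bind `[Field F] [Field E] [NumberField E] [Algebra F E]` — exactly what their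
  bodies use (`𝔸_E = AdeleRing (𝓞 E) E` needs `E` a number field).  The printed hypotheses of the SETTING («`F` … totally
  real number field», «`E/F` … totally imaginary quadratic») are the Mathlib instances `[NumberField F] [IsTotallyReal F]
  [IsTotallyComplex E] [Algebra.IsQuadraticExtension F E]` of `Liu2021/Thm418AsPrinted.lean`; no clause of Def. C.4 uses
  them, so (a Lean declaration binds only the instances it uses) they are not binders here — they are binders of the
  OBJECTS `V`, `𝕍` (file `DefC1toC3.lean`) and of Thm. 4.18's datum, with which these predicates are instantiated.  «the nontrivial involution `c` of
  `E` over `F`» is the explicit binder `(c : E ≃ₐ[F] E)` — the tree's currency for `c` and for the induced involution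
  `c ⊗ 1` of `𝔸_E = E ⊗_F 𝔸_F` and of `𝔸_E^∞` (`UnitaryGroup.conjAdele F E c`, `UnitaryGroup.conjFiniteAdele F E c`, files
  `UnitaryGroupAutomorphicRep`, `UnitaryGroupRestrictedProduct`); its non-triviality is a hypothesis of the setting carried
  by the objects, not used by the bodies here.  `Φ_F` = `F →+* ℝ`, `Φ_E` = `E →+* ℂ`, `π` = restriction (`LiesAbove`).
* READING N1 (presentation by matrices).  «hermitian space `V` over `E` … of rank `n`» (l. 4558) enters Def. C.4 through
  the MATRIX `J : Matrix (Fin n) (Fin n) E` of its form in a basis (`V ≅ E^n`), in the convention of the tree's unitary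
  groups (`unitaryGroupOfForm σ J = {g | (σ g)ᵀ J g = J}`, file `UnitaryGroupAutomorphicRep`; `HermSpace3.Hm`;
  `UnitaryBallUniformisationDatum.H`): `J i j = (e_j, e_i)_V`, i.e. `(x, y)_V = Σ_{i,j} x_j · J i j · c(y_i)` — `E`-linear in
  the first variable as printed; `J` is the transpose of the Gram matrix `((e_i, e_j)_V)`, a relabelling under which
  isometry classes and signatures — the only things Def. C.4 speaks about — are unchanged.  Likewise the incoherent space
  `𝕍` of l. 4618, «a free `𝔸_E`-module of some rank `n`» with the form `( , )_𝕍` (Def. C.3), enters through its matrix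
  `𝕁 : Matrix (Fin n) (Fin n) (AdeleRing (𝓞 E) E)` in an `𝔸_E`-basis, same convention.  The printed ATTRIBUTES of the two
  objects (hermitian, non-degenerate; incoherent, totally positive definite) are hypotheses ON THE OBJECTS — fields of the
  structures of `DefC1toC3.lean`, whose matrix fields are fed to the predicates here (file `Glue.lean`) — and are not
  restated inside Def. C.4, which does not print them.
* READING N2 (the single printed isomorphism over `𝔸_F^τ`, factor by factor).  `E ⊗_F 𝔸_F^τ = ∏_{w ∤ τ} E_w × 𝔸_E^∞` is a
  product of rings and `GL_n` of a product is the product of the `GL_n`'s, so an isometry `V ⊗_F 𝔸_F^τ ≃ 𝕍 ⊗_{𝔸_F} 𝔸_F^τ`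
  is exactly: an isometry over `𝔸_E^∞` (`IsometricFinite`: `∃ g ∈ GL_n(𝔸_E^∞)`, `((c ⊗ 1) g)ᵀ · J · g = 𝕁^∞`) together with
  an isometry over `E_w` for every archimedean place `w` of `E` not above `τ` (`IsometricAt w`).  Mathlib has no ring
  `𝔸_F^τ`; this conjunction IS the definition of an isomorphism over the product ring.
* READING N3 (archimedean components through `ℂ`).  For an archimedean place `w` of `E`, Mathlib's
  `InfinitePlace.Completion.extensionEmbedding w : E_w →+* ℂ` is an isomorphism of topological fields (`E_w` is complex:
  `E` is totally imaginary) extending the embedding `w.embedding : E →+* ℂ` (`extensionEmbedding_coe`), under which the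
  involution `c_w = c ⊗ 1` of `E_w = E ⊗_F F_{τ₁}` becomes complex conjugation (`w.embedding ∘ c = conj ∘ w.embedding` for a
  CM extension).  So «`V ⊗_F F_{τ₁} ≃ 𝕍 ⊗_{𝔸_F} F_{τ₁}`» at the place `τ₁ = w|_F` reads: `∃ T ∈ GL_n(ℂ)`,
  `Tᴴ · J^{w.embedding} · T = (𝕁_w)^{extensionEmbedding w}` (`ᴴ` = conjugate transpose) — l. 4573's identification
  «`V ⊗_{E,τ^−} ℂ` with `ℂ^{⊕n}`».
* READING N4 (signature).  «`V ⊗_{F,τ} ℝ` has signature `(p, q)`» (l. 4558, 4573): `p + q = n` and, for an embedding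
  `τ' ∈ Φ_E` above `τ` identifying `V ⊗_{E,τ'} ℂ` with `ℂ^{⊕n}` (l. 4573 uses `τ' = τ^−`), the hermitian matrix `J^{τ'}` is
  congruent to `diag(I_p, −I_q)`: `∃ T ∈ GL_n(ℂ)`, `Tᴴ · J^{τ'} · T = diag(I_p, −I_q)` (Sylvester).  The two embeddings above
  `τ` are complex conjugate and give transposed matrices `J^{\bar τ'} = (J^{τ'})ᵀ` for hermitian `J`, of the same signature, so
  the choice of `τ'` is immaterial, as the printed phrase presumes; the predicate asks for SOME `τ'` above `τ`
  (`HasSignatureAt`), the form in which l. 4573 uses it.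

NOT part of Def. C.4 and NOT typed here: the existence and uniqueness of a `τ`-nearby space, the fixed `V(τ)`, `G(τ)`, the
fixed isomorphisms `𝕍 ⊗_{𝔸_F} 𝔸_F^∞ ≃ V(τ) ⊗_F 𝔸_F^∞` and `𝔾(𝔸_F^∞) ≃ G(τ)(𝔸^∞)` (all l. 4624 → `Glue.lean`; a witness `g` of
`IsometricFinite` below is precisely such a fixed isomorphism, and congruent matrices have conjugate unitary groups:
tree `unitaryGroupCongr`, `adelicUnitaryGroupCongr`, file `AdelicUnitaryGroup`); any condition on `d = [F:ℚ]`, on `n`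
beyond the standing `n ≥ 1` of l. 4618 (§4.2 of the paper later takes `n ≥ 2`, l. 2053 — not here), any compactness /
anisotropy statement (l. 2861 «In particular, `V` is anisotropic» is a CONSEQUENCE in the Compact Case, not a clause).

## References

* [Liu2021] Y. Liu, *Fourier–Jacobi cycles and arithmetic relative trace formula*, Camb. J. Math. 9 (2021) 1–147,
  arXiv:2102.11518 — App. C preamble l. 4550, §C.1 l. 4558, 4573, Def. C.3 (l. 4614–4616), l. 4618, **Def. C.4
  (l. 4620–4622)**, l. 4624.
-/

noncomputable section

open NumberField NumberField.InfinitePlace IsDedekindDomain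
open scoped Matrix

namespace Literature.NumberTheory.Automorphic.Liu2021.AppendixC

/-! ## `Φ_F`, `Φ_E`, `π` (l. 4550) -/

section Embeddings

variable {F E : Type} [Field F] [Field E] [Algebra F E]

/-- «the projection map `π : Φ_E → Φ_F` given by restriction» (l. 4550): the complex embedding `τ' ∈ Φ_E` of `E` lies
ABOVE the real embedding `τ ∈ Φ_F` of `F`, `π(τ') = τ`, iff `τ'` restricted to `F` is `τ` (followed by `ℝ ⊆ ℂ`).
[cite: Liu2021, App. C l. 4550] -/
def LiesAbove (τ' : E →+* ℂ) (τ : F →+* ℝ) : Prop :=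
  ∀ x : F, τ' (algebraMap F E x) = (τ x : ℂ)

/-- Unfolding of `LiesAbove`. [cite: Liu2021, App. C l. 4550] -/
theorem liesAbove_iff (τ' : E →+* ℂ) (τ : F →+* ℝ) :
    LiesAbove τ' τ ↔ ∀ x : F, τ' (algebraMap F E x) = (τ x : ℂ) :=
  Iff.rfl

/-- The archimedean place of `F` defined by the real embedding `τ ∈ Φ_F` (`F` is totally real, l. 4550, so `Φ_F` is in
bijection with the archimedean places of `F`; `𝔸_F^τ` is «away from» this place). [cite: Liu2021, App. C l. 4550, 4621] -/
def placeOf (τ : F →+* ℝ) : InfinitePlace F :=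
  InfinitePlace.mk ((algebraMap ℝ ℂ).comp τ)

/-- An archimedean place `w` of `E` lies above `τ ∈ Φ_F` iff its restriction to `F` is the place of `τ`; `𝔸_F^τ`-components
are indexed by the `w` for which this FAILS (READING N2). [cite: Liu2021, App. C l. 4621] -/
def PlaceLiesAbove (w : InfinitePlace E) (τ : F →+* ℝ) : Prop :=
  w.comap (algebraMap F E) = placeOf τ

end Embeddings

/-! ## Signature of `V ⊗_{F,τ} ℝ` (l. 4558, 4573) -/

section Signature

variable {F E : Type} [Field F] [Field E] [Algebra F E] {n : ℕ}

/-- The matrix `diag(I_p, −I_q)` of l. 4573 («the hermitian form given by the matrix `( I_{p_τ} 0 ; 0 −I_{q_τ} )`») on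
`ℂ^{⊕n}`, `p = n − q`: diagonal with the first `n − q` entries `1` and the last `q` entries `−1`.
[cite: Liu2021, App. C l. 4573] -/
def signatureDiag (n q : ℕ) : Matrix (Fin n) (Fin n) ℂ :=
  Matrix.diagonal fun i => if (i : ℕ) < n - q then 1 else -1

/-- Entries of `signatureDiag`. [cite: Liu2021, App. C l. 4573] -/
theorem signatureDiag_apply (n q : ℕ) (i j : Fin n) :
    signatureDiag n q i j = if i = j then (if (i : ℕ) < n - q then 1 else -1) else 0 := by
  unfold signatureDiag
  by_cases h : i = j
  · subst h; simp
  · simp [h]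

/-- **«`V ⊗_{F,τ} ℝ` has signature `(p, q)`»** (l. 4558: «For every `τ ∈ Φ_F`, let `(p_τ, q_τ)` be the signature of
`V ⊗_{F,τ} ℝ`»; l. 4573: «we may identify `V ⊗_{E,τ^−} ℂ` with `ℂ^{⊕n}`, hence `U(V) ⊗_{F,τ} ℝ` is identified with the subgroup
of `Res_{ℂ/ℝ} GL_n` of elements preserving the hermitian form given by the matrix `( I_{p_τ} 0 ; 0 −I_{q_τ} )`»), for the
hermitian space `V ≅ E^n` presented by the matrix `J` (READING N1): `p + q = n` and for some `τ' ∈ Φ_E` above `τ` the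
matrix `J^{τ'} ∈ M_n(ℂ)` is congruent to `diag(I_p, −I_q)` — `∃ T ∈ GL_n(ℂ)`, `Tᴴ · J^{τ'} · T = diag(I_p, −I_q)` (READING N4:
for hermitian `J` the choice of `τ'` above `τ` is immaterial). [cite: Liu2021, App. C l. 4558, 4573] -/
def HasSignatureAt (τ : F →+* ℝ) (J : Matrix (Fin n) (Fin n) E) (p q : ℕ) : Prop :=
  p + q = n ∧ ∃ τ' : E →+* ℂ, LiesAbove τ' τ ∧
    ∃ T : GL (Fin n) ℂ, (T : Matrix (Fin n) (Fin n) ℂ)ᴴ * J.map τ' * (T : Matrix (Fin n) (Fin n) ℂ) = signatureDiag n q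

/-- Unfolding of `HasSignatureAt`. [cite: Liu2021, App. C l. 4558, 4573] -/
theorem hasSignatureAt_iff (τ : F →+* ℝ) (J : Matrix (Fin n) (Fin n) E) (p q : ℕ) :
    HasSignatureAt τ J p q ↔ p + q = n ∧ ∃ τ' : E →+* ℂ, LiesAbove τ' τ ∧
      ∃ T : GL (Fin n) ℂ, (T : Matrix (Fin n) (Fin n) ℂ)ᴴ * J.map τ' * (T : Matrix (Fin n) (Fin n) ℂ) =
        signatureDiag n q :=
  Iff.rfl

end Signature

/-! ## `V ⊗_F 𝔸_F^τ ≃ 𝕍 ⊗_{𝔸_F} 𝔸_F^τ` (l. 4621), factor by factor (READING N2) -/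

section Isometry

variable (F : Type) {E : Type} [Field F] [Field E] [NumberField E] [Algebra F E]
variable (c : E ≃ₐ[F] E) {n : ℕ}

/-- The `w`-component `𝔸_E → E_w` at an archimedean place `w` of `E` (`𝔸_E = (∏_w E_w) × 𝔸_E^∞`, Mathlib's
`AdeleRing (𝓞 E) E = InfiniteAdeleRing E × FiniteAdeleRing (𝓞 E) E`); the archimedean factors of `𝕍 ⊗_{𝔸_F} 𝔸_F^τ`
(READING N2) are read off through it. [cite: Liu2021, Def. C.4 (l. 4621)] -/
def infComponent (w : InfinitePlace E) : AdeleRing (𝓞 E) E →+* w.Completion :=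
  (Pi.evalRingHom (fun v : InfinitePlace E => v.Completion) w).comp
    (RingHom.fst (InfiniteAdeleRing E) (FiniteAdeleRing (𝓞 E) E))

/-- `infComponent w a = a.1 w` (definitional unfolding of the presentation, READING N2). [cite: Liu2021, Def. C.4 (l. 4621)] -/
@[simp] theorem infComponent_apply (w : InfinitePlace E) (a : AdeleRing (𝓞 E) E) : infComponent w a = a.1 w := rfl

/-- The finite part `𝔸_E → 𝔸_E^∞` (Mathlib `RingHom.snd`; = the tree's `UnitaryGroup.adeleSnd`); the finite-adelic factor
`𝕍 ⊗_{𝔸_F} 𝔸_F^∞` of `𝕍 ⊗_{𝔸_F} 𝔸_F^τ` (READING N2) is read off through it. [cite: Liu2021, Def. C.4 (l. 4621), l. 4624] -/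
def finComponent : AdeleRing (𝓞 E) E →+* FiniteAdeleRing (𝓞 E) E :=
  RingHom.snd (InfiniteAdeleRing E) (FiniteAdeleRing (𝓞 E) E)

/-- `finComponent a = a.2` (definitional unfolding of the presentation, READING N2). [cite: Liu2021, Def. C.4 (l. 4621)] -/
@[simp] theorem finComponent_apply (a : AdeleRing (𝓞 E) E) : finComponent a = a.2 := rfl

/-- **The finite-adelic factor of «`V ⊗_F 𝔸_F^τ ≃ 𝕍 ⊗_{𝔸_F} 𝔸_F^τ`»** (l. 4621; = the isomorphism «`𝕍 ⊗_{𝔸_F} 𝔸_F^∞ ≃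
V(τ) ⊗_F 𝔸_F^∞`» that l. 4624 then FIXES): the hermitian spaces `V ⊗_F 𝔸_F^∞ ≅ ((𝔸_E^∞)^n, J)` and `𝕍 ⊗_{𝔸_F} 𝔸_F^∞ ≅
((𝔸_E^∞)^n, 𝕁^∞)` over `𝔸_E^∞ = E ⊗_F 𝔸_F^∞` (involution `c ⊗ 1` = tree `UnitaryGroup.conjFiniteAdele F E c`) are isometric:
`∃ g ∈ GL_n(𝔸_E^∞)` with `((c ⊗ 1) g)ᵀ · J · g = 𝕁^∞` — the convention of the tree's `unitaryGroupOfForm` /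
`UnitaryGroup.finAdelic F E c n J = U(V)(𝔸_F^∞)`, so that such a `g` conjugates `U(𝕍)(𝔸_F^∞)` onto `U(V)(𝔸_F^∞)` inside
`GL_n(𝔸_E^∞)`. READINGS N1, N2. [cite: Liu2021, Def. C.4 (l. 4621)] -/
def IsometricFinite (J : Matrix (Fin n) (Fin n) E) (𝕁 : Matrix (Fin n) (Fin n) (AdeleRing (𝓞 E) E)) : Prop :=
  ∃ g : GL (Fin n) (FiniteAdeleRing (𝓞 E) E),
    ((g : Matrix (Fin n) (Fin n) (FiniteAdeleRing (𝓞 E) E)).map (UnitaryGroup.conjFiniteAdele F E c))ᵀ *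
        J.map (algebraMap E (FiniteAdeleRing (𝓞 E) E)) * (g : Matrix (Fin n) (Fin n) (FiniteAdeleRing (𝓞 E) E)) =
      𝕁.map finComponent

/-- **The factor of «`V ⊗_F 𝔸_F^τ ≃ 𝕍 ⊗_{𝔸_F} 𝔸_F^τ`» at an archimedean place `w` of `E`** (l. 4621), i.e. «`V ⊗_F F_{τ₁} ≃
𝕍 ⊗_{𝔸_F} F_{τ₁}`» at `τ₁ = w|_F ∈ Φ_F` (`E ⊗_F F_{τ₁} = E_w ≅ ℂ`): through Mathlib's `extensionEmbedding w : E_w →+* ℂ`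
(extending `w.embedding : E →+* ℂ`; `c ⊗ 1 ↦` complex conjugation, READING N3) the hermitian matrices `J^{w.embedding}` and
`(𝕁_w)^{extensionEmbedding w}` on `ℂ^{⊕n}` are congruent: `∃ T ∈ GL_n(ℂ)`, `Tᴴ · J^{w.embedding} · T = (𝕁_w)^{extensionEmbedding w}`.
[cite: Liu2021, Def. C.4 (l. 4621) with l. 4573] -/
def IsometricAt (w : InfinitePlace E) (J : Matrix (Fin n) (Fin n) E)
    (𝕁 : Matrix (Fin n) (Fin n) (AdeleRing (𝓞 E) E)) : Prop :=
  ∃ T : GL (Fin n) ℂ,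
    (T : Matrix (Fin n) (Fin n) ℂ)ᴴ * J.map w.embedding * (T : Matrix (Fin n) (Fin n) ℂ) =
      (𝕁.map (infComponent w)).map (Completion.extensionEmbedding w)

/-- **«`V ⊗_F 𝔸_F^τ ≃ 𝕍 ⊗_{𝔸_F} 𝔸_F^τ`»** (first clause of Def. C.4, l. 4621): the hermitian spaces `V ⊗_F 𝔸_F^τ` and
`𝕍 ⊗_{𝔸_F} 𝔸_F^τ` over `E ⊗_F 𝔸_F^τ = ∏_{w ∤ τ} E_w × 𝔸_E^∞` are isometric — READING N2: an isometry over the finite adèles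
(`IsometricFinite`) and one over `E_w` for every archimedean place `w` of `E` NOT above `τ` (`IsometricAt w`); nothing is
required at the place above `τ` (there the second clause of Def. C.4 prescribes the signature `(n−1,1)` of `V`, while `𝕍` is
positive definite, l. 4618). [cite: Liu2021, Def. C.4 (l. 4621)] -/
def IsometricAway (τ : F →+* ℝ) (J : Matrix (Fin n) (Fin n) E)
    (𝕁 : Matrix (Fin n) (Fin n) (AdeleRing (𝓞 E) E)) : Prop :=
  IsometricFinite F c J 𝕁 ∧ ∀ w : InfinitePlace E, ¬ PlaceLiesAbove w τ → IsometricAt w J 𝕁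

/-- `𝔸_E^∞`-part of a principal adelic matrix: `(J ⊗ 1)^∞ = J` over `𝔸_E^∞` (componentwise `rfl`) — the matrix of the
coherent space `V ⊗_F 𝔸_F` restricted to `𝔸_F^∞` is that of `V ⊗_F 𝔸_F^∞` (presentation check, READING N1/N2).
[cite: Liu2021, Def. C.4 (l. 4621)] -/
theorem map_algebraMap_map_finComponent (J : Matrix (Fin n) (Fin n) E) :
    (J.map (algebraMap E (AdeleRing (𝓞 E) E))).map finComponent =
      J.map (algebraMap E (FiniteAdeleRing (𝓞 E) E)) := by
  rw [Matrix.map_map]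
  rfl

/-- CONVENTION CHECK / non-vacuity of the finite factor: the coherent adelisation `V ⊗_F 𝔸_F` of `V` (matrix `J ⊗ 1` over
`𝔸_E`) is isometric to `V` over the finite adèles, by `g = 1` (our bookkeeping on the typed clause «`V ⊗_F 𝔸_F^τ ≃
𝕍 ⊗_{𝔸_F} 𝔸_F^τ`», not a statement of the paper about `𝕍`). [cite: Liu2021, Def. C.4 (l. 4621)] -/
theorem isometricFinite_self (J : Matrix (Fin n) (Fin n) E) :
    IsometricFinite F c J (J.map (algebraMap E (AdeleRing (𝓞 E) E))) := by
  refine ⟨1, ?_⟩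
  rw [map_algebraMap_map_finComponent, Units.val_one,
    Matrix.map_one _ (map_zero _) (map_one _), Matrix.transpose_one, Matrix.one_mul, Matrix.mul_one]

/-- The archimedean component at `w` of a principal adele, pushed into `ℂ` by `extensionEmbedding w`, is `w.embedding`
(Mathlib `extensionEmbedding_coe`): the dictionary of READING N3 («identify `V ⊗_{E,τ^−} ℂ` with `ℂ^{⊕n}`», l. 4573) on
principal elements. [cite: Liu2021, App. C l. 4573 with Def. C.4 (l. 4621)] -/
theorem extensionEmbedding_infComponent_algebraMap (w : InfinitePlace E) (x : E) :
    Completion.extensionEmbedding w (infComponent w (algebraMap E (AdeleRing (𝓞 E) E) x)) = w.embedding x := by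
  rw [infComponent_apply, AdeleRing.algebraMap_fst_apply]
  exact Completion.extensionEmbedding_coe w ((WithAbs.equiv w.1).symm x)

/-- CONVENTION CHECK / non-vacuity of the archimedean factors: the coherent adelisation of `V` is isometric to `V` at every
archimedean place `w`, by `T = 1` (our bookkeeping on the typed clause, as for `isometricFinite_self`).
[cite: Liu2021, Def. C.4 (l. 4621) with l. 4573] -/
theorem isometricAt_self (w : InfinitePlace E) (J : Matrix (Fin n) (Fin n) E) :
    IsometricAt w J (J.map (algebraMap E (AdeleRing (𝓞 E) E))) := by
  refine ⟨1, ?_⟩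
  rw [Units.val_one, Matrix.conjTranspose_one, Matrix.one_mul, Matrix.mul_one, Matrix.map_map, Matrix.map_map]
  congr 1
  funext x
  exact (extensionEmbedding_infComponent_algebraMap w x).symm

/-! ## Definition C.4, exactly as printed -/

/-- **[Liu2021, Definition C.4] EXACTLY AS PRINTED** (`FJcycle.tex` l. 4620–4622, TeX label `de:nearby`), in the setting of
l. 4550 (`F` totally real, `E/F` totally imaginary quadratic, `c` the nontrivial involution of `E` over `F`) and l. 4618
(«Let `𝕍` be a totally positive definite incoherent hermitian space over `𝔸_E` of rank `n ≥ 1`», Def. C.3 — the object of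
`AppendixC/DefC1toC3.lean`, entering here through its matrix `𝕁 ∈ M_n(𝔸_E)`, READING N1):

«For `τ ∈ Φ_F`, we say that a hermitian space `V` over `E` is *`τ`-nearby to `𝕍`* if `V ⊗_F 𝔸_F^τ ≃ 𝕍 ⊗_{𝔸_F} 𝔸_F^τ`, and
`V ⊗_{F,τ} ℝ` has signature `(n−1, 1)`.»

TYPED, for `τ : F →+* ℝ` (`τ ∈ Φ_F`) and the hermitian space `V` over `E` of rank `n` presented by its matrix `J ∈ M_n(E)`
(l. 4558, READING N1), as the conjunction of the two printed clauses: `IsometricAway F c τ J 𝕁` («`V ⊗_F 𝔸_F^τ ≃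
𝕍 ⊗_{𝔸_F} 𝔸_F^τ`», READINGS N2–N3) and `HasSignatureAt τ J (n − 1) 1` («`V ⊗_{F,τ} ℝ` has signature `(n−1, 1)`», READING N4;
`n ≥ 1` by l. 4618, so `(n − 1) + 1 = n`).  No clause added, none dropped; the attributes of `V` (hermitian, non-degenerate)
and of `𝕍` (Def. C.3, totally positive definite) are hypotheses on the objects, not clauses of this definition.  The
existence / uniqueness of such `V` and the fixed `V(τ)`, `G(τ)`, `𝔾(𝔸_F^∞) ≃ G(τ)(𝔸^∞)` are l. 4624, not Def. C.4.
[cite: Liu2021, Def. C.4 (l. 4620–4622)] -/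
def IsNearby (𝕁 : Matrix (Fin n) (Fin n) (AdeleRing (𝓞 E) E)) (τ : F →+* ℝ) (J : Matrix (Fin n) (Fin n) E) : Prop :=
  IsometricAway F c τ J 𝕁 ∧ HasSignatureAt τ J (n - 1) 1

/-- Unfolding of Def. C.4 into its two printed clauses. [cite: Liu2021, Def. C.4 (l. 4620–4622)] -/
theorem isNearby_iff (𝕁 : Matrix (Fin n) (Fin n) (AdeleRing (𝓞 E) E)) (τ : F →+* ℝ) (J : Matrix (Fin n) (Fin n) E) :
    IsNearby F c 𝕁 τ J ↔ IsometricAway F c τ J 𝕁 ∧ HasSignatureAt τ J (n - 1) 1 :=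
  Iff.rfl

/-- First printed clause: a `τ`-nearby `V` is isometric to `𝕍` away from `τ`; in particular over the finite adèles — the
isomorphism «`𝕍 ⊗_{𝔸_F} 𝔸_F^∞ ≃ V(τ) ⊗_F 𝔸_F^∞`» that l. 4624 fixes exists. [cite: Liu2021, Def. C.4 (l. 4621), l. 4624] -/
theorem IsNearby.isometricFinite {𝕁 : Matrix (Fin n) (Fin n) (AdeleRing (𝓞 E) E)} {τ : F →+* ℝ}
    {J : Matrix (Fin n) (Fin n) E} (h : IsNearby F c 𝕁 τ J) : IsometricFinite F c J 𝕁 :=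
  h.1.1

/-- Second printed clause: a `τ`-nearby `V` has signature `(n−1, 1)` at `τ`. [cite: Liu2021, Def. C.4 (l. 4621–4622)] -/
theorem IsNearby.hasSignatureAt {𝕁 : Matrix (Fin n) (Fin n) (AdeleRing (𝓞 E) E)} {τ : F →+* ℝ}
    {J : Matrix (Fin n) (Fin n) E} (h : IsNearby F c 𝕁 τ J) : HasSignatureAt τ J (n - 1) 1 :=
  h.2

/-! ## The same definition on the modules themselves (bases chosen inside the `Prop`) -/

section Modules

variable {R M : Type} [CommRing R] [AddCommGroup M] [Module R M] {m : ℕ}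

/-- The matrix of a form `( , ) : M × M → R` in a basis `b = (b_0, …, b_{m−1})` of `M`, in the convention of READING N1:
entry `(i, j)` is `(b_j, b_i)` (so that for `( , )` `R`-linear in the first variable and `c`-semilinear in the second,
`(x, y) = Σ_{i,j} x_j · J i j · c(y_i)` in `b`-coordinates, and the isometry group is the tree's `unitaryGroupOfForm c J`).
[cite: Liu2021, App. C l. 4558 (the form `( , )_V`), Def. C.3 (l. 4614, the form `( , )_𝕍`)] -/
def matrixOfForm (form : M → M → R) (b : Module.Basis (Fin m) R M) : Matrix (Fin m) (Fin m) R :=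
  fun i j => form (b j) (b i)

/-- Entries of `matrixOfForm`. [cite: Liu2021, App. C l. 4558] -/
@[simp] theorem matrixOfForm_apply (form : M → M → R) (b : Module.Basis (Fin m) R M) (i j : Fin m) :
    matrixOfForm form b i j = form (b j) (b i) := rfl

end Modules

section Spaces

variable (F : Type) {E : Type} [Field F] [Field E] [NumberField E] [Algebra F E] (c : E ≃ₐ[F] E) {n : ℕ}

/-- **Definition C.4 on the spaces themselves.**  For the incoherent hermitian space `𝕍` of l. 4618 given, as printed in
Def. C.3, as «a free `𝔸_E`-module `𝕍` of some rank `n`» — an `𝔸_E`-module with a basis `b𝕍 : Fin n → 𝕍` — «equipped with a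
… hermitian form `( , )_𝕍 : 𝕍 × 𝕍 → 𝔸_E`», for `τ ∈ Φ_F`, and for «a hermitian space `V` over `E`» given as an `E`-module with
its form `( , )_V : V × V → E` (l. 4558): `V` is `τ`-nearby to `𝕍` iff in SOME `E`-basis of `V` indexed by `Fin n` (one
exists iff `dim_E V = n`, which the printed isomorphism `V ⊗_F 𝔸_F^τ ≃ 𝕍 ⊗_{𝔸_F} 𝔸_F^τ` forces) the matrices of the two
forms satisfy `IsNearby` — equivalently in EVERY such basis (isometry classes and signatures do not depend on the basis;
READING N1).  This is the form a bundled «hermitian space» / «incoherent hermitian space» structure (file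
`DefC1toC3.lean`: carrier, form, basis) is fed to Def. C.4 (file `Glue.lean`). [cite: Liu2021, Def. C.4 (l. 4620–4622)] -/
def IsNearbySpace {𝕍 : Type} [AddCommGroup 𝕍] [Module (AdeleRing (𝓞 E) E) 𝕍]
    (b𝕍 : Module.Basis (Fin n) (AdeleRing (𝓞 E) E) 𝕍) (form𝕍 : 𝕍 → 𝕍 → AdeleRing (𝓞 E) E) (τ : F →+* ℝ)
    {V : Type} [AddCommGroup V] [Module E V] (formV : V → V → E) : Prop :=
  ∃ bV : Module.Basis (Fin n) E V, IsNearby F c (matrixOfForm form𝕍 b𝕍) τ (matrixOfForm formV bV)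

/-- Unfolding of `IsNearbySpace`. [cite: Liu2021, Def. C.4 (l. 4620–4622)] -/
theorem isNearbySpace_iff {𝕍 : Type} [AddCommGroup 𝕍] [Module (AdeleRing (𝓞 E) E) 𝕍]
    (b𝕍 : Module.Basis (Fin n) (AdeleRing (𝓞 E) E) 𝕍) (form𝕍 : 𝕍 → 𝕍 → AdeleRing (𝓞 E) E) (τ : F →+* ℝ)
    {V : Type} [AddCommGroup V] [Module E V] (formV : V → V → E) :
    IsNearbySpace F c b𝕍 form𝕍 τ formV ↔
      ∃ bV : Module.Basis (Fin n) E V, IsNearby F c (matrixOfForm form𝕍 b𝕍) τ (matrixOfForm formV bV) :=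
  Iff.rfl

end Spaces

end Isometry

end Literature.NumberTheory.Automorphic.Liu2021.AppendixC

end
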